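import Literature.Probability.Percolation.AnnulusAlternation
import HarnessLib

/-!
# Order transfer between the two circles of an annulus: crossing paths keep their cyclic order

Topic `Literature/Probability/Percolation`; family `crit-perc` (planar combinatorics of site
percolation on `𝕋`). A brick of the near-critical arm-separation theorem for four arms of
alternating colours (P. Nolin, *Near-critical percolation in two dimensions*, EJP 13 (2008),
Thm. 11 for `j = 4`, `σ = BWBW` [arXiv 0711.4948: Thm. 10]): at the INTERNAL extremities the
four arms, already landed on the sides `0, 2, 3, 5` of the outer boundary, must be routed inside
`Λ_m` from their fenced inner tips on `∂Λ_m`, which needs the anticlockwise ORDER of the four tips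
on `∂Λ_m` — and this order is that of the outer landing sides. The topological statement is: pairwise
disjoint paths crossing the annulus `A = {n ≤ |v| ≤ N}` meet the two circles in the same cyclic
order. We prove it in the following form (`hexShift_lt_iff_of_slit`): fix a *slit* — the support
`S` of a clean crossing path (`IsSlit`: from `s₁ ∈ ∂Λ_n` to `t₁ ∈ ∂Λ_N`, all other sites strictly
between the circles) — and two paths `Q : q ⇝ q'`, `R : r ⇝ r'` of `A ∖ S` from `∂Λ_n` to `∂Λ_N`
with disjoint supports; then `q` comes before `r` anticlockwise from `s₁` on `∂Λ_n` iff `q'` comes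
before `r'` anticlockwise from `t₁` on `∂Λ_N` (`hexShift`).

Proof: with the slit as a fake configuration, `AnnulusAlternation` makes the complement
`U = A ∖ S` the component `annComp n N S s₁ q`, a disc (`exists_isTriDisc_annComp`); its boundary
darts point into the hole, to the outside, or into the slit. Along the boundary cycle the hole darts
sweep the inner circle CLOCKWISE and the outside darts sweep the outer circle ANTICLOCKWISE
(local successor lemmas `holeDart_steps`, `outDart_steps`, by rotation to the right side and an
explicit computation of the left apex); based at a hole dart at `q`, the cycle reads: inner sites
clockwise from `q` down to `s₁`, then (among others) all outside darts anticlockwise from `t₁`, then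
the remaining inner sites clockwise down to `q`; an order reversal would give two disjoint paths of
the disc with interleaved ends, excluded by `IsTriDisc.not_interleaved` (Bollobás–Riordan, Ch. 7,
Lemma 5).

Everything here is proved; no named facts are introduced.

## References

* B. Bollobás, O. Riordan, *Percolation*, CUP (2006), Ch. 7 §7.2.2, Lemma 5 p. 169 [BollobasRiordan2006].
* H. Kesten, *Percolation theory for mathematicians* (1982), §2.2–2.3 [KestenPTM1982].
* P. Nolin, Near-critical percolation in two dimensions, EJP 13 (2008), §4.4 (arXiv 0711.4948: proof of Thm. 10, internal extremities) [Nolin2008].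

Tree: `triBdrySucc/triBdryIter/triBdryDarts`, `IsTriDisc` (+ `rebase`, `iter_mod`, `injOn`,
`not_interleaved`), `annComp`, `annCompFin`, `exists_isTriDisc_annComp`, `head_cases`,
`norm_of_hole_dart`, `norm_of_out_dart`, `hexPos`, `hexShift`, `triBall_not_interleaved`,
`exists_rot_side0`, `hexPos_rot_side0`, `side0_out_cases`, `triLeftApex_vec`, `triLeftApex_rot`.
-/

noncomputable section

open Finset

namespace Literature.Probability.Percolation

open LatticeModels

/-! ### Rotation covariance of the boundary traversal of an arbitrary finite set -/

/-- Membership of a rotated site in a rotated set. [folklore] -/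
theorem mem_image_rot_iff (i : ℕ) (G : Finset (Site 2)) (v : Site 2) :
    triRotIsoPow i v ∈ G.image (triRotIsoPow i) ↔ v ∈ G :=
  (triRotIsoPow i).injective.mem_finset_image

/-- **The anticlockwise boundary successor is rotation covariant** (any finite set). [folklore] -/
theorem triBdrySucc_image_rot (i : ℕ) (G : Finset (Site 2)) (x y : Site 2) :
    triBdrySucc (G.image (triRotIsoPow i)) (triRotIsoPow i x, triRotIsoPow i y) =
      (triRotIsoPow i (triBdrySucc G (x, y)).1, triRotIsoPow i (triBdrySucc G (x, y)).2) := by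
  unfold triBdrySucc
  simp only
  rw [triLeftApex_rot]
  by_cases h : triLeftApex x y ∈ G
  · rw [if_pos ((mem_image_rot_iff i G _).2 h), if_pos h]
  · rw [if_neg (fun h' => h ((mem_image_rot_iff i G _).1 h')), if_neg h]

/-- One step of the traversal. [folklore] -/
theorem triBdryIter_one (G : Finset (Site 2)) (d : Site 2 × Site 2) : triBdryIter G d 1 = triBdrySucc G d := rfl

/-- Two steps of the traversal. [folklore] -/
theorem triBdryIter_two (G : Finset (Site 2)) (d : Site 2 × Site 2) : triBdryIter G d 2 = triBdrySucc G (triBdrySucc G d) := rfl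

/-- The boundary traversal is rotation covariant. [folklore] -/
theorem triBdryIter_image_rot (i : ℕ) (G : Finset (Site 2)) (d : Site 2 × Site 2) (k : ℕ) :
    triBdryIter (G.image (triRotIsoPow i)) (triRotIsoPow i d.1, triRotIsoPow i d.2) k =
      (triRotIsoPow i (triBdryIter G d k).1, triRotIsoPow i (triBdryIter G d k).2) := by
  induction k with
  | zero => rfl
  | succ k ih => rw [triBdryIter_succ, ih, triBdrySucc_image_rot, ← triBdryIter_succ]

/-- Boundary darts of a rotated set. [folklore] -/
theorem mem_triBdryDarts_image_rot (i : ℕ) (G : Finset (Site 2)) (x y : Site 2) :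
    (triRotIsoPow i x, triRotIsoPow i y) ∈ triBdryDarts (G.image (triRotIsoPow i)) ↔ (x, y) ∈ triBdryDarts G := by
  rw [mem_triBdryDarts, mem_triBdryDarts]
  simp only [mem_image_rot_iff, rot_adj_iff]

/-- Undoing a rotation: `ρ^i (ρ^(6-i) v) = v` for `i ≤ 6`. [folklore] -/
theorem rot_rot_six_sub (i : ℕ) (hi : i ≤ 6) (v : Site 2) : triRotIsoPow i (triRotIsoPow (6 - i) v) = v := by
  rw [← triRotIsoPow_add_apply, show 6 - i + i = 6 by omega, triRotIsoPow_six_apply]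

/-- Undoing a rotation: `ρ^(6-i) (ρ^i v) = v` for `i ≤ 6`. [folklore] -/
theorem rot_six_sub_rot (i : ℕ) (hi : i ≤ 6) (v : Site 2) : triRotIsoPow (6 - i) (triRotIsoPow i v) = v := by
  rw [← triRotIsoPow_add_apply, show i + (6 - i) = 6 by omega, triRotIsoPow_six_apply]

/-- A set is the rotation by `ρ^i` of its rotation by `ρ^(6-i)`. [folklore] -/
theorem image_rot_image_rot_six_sub (i : ℕ) (hi : i ≤ 6) (G : Finset (Site 2)) :
    (G.image (triRotIsoPow (6 - i))).image (triRotIsoPow i) = G := by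
  rw [Finset.image_image]
  have : (⇑(triRotIsoPow i) ∘ ⇑(triRotIsoPow (6 - i))) = id := funext fun v => rot_rot_six_sub i hi v
  rw [this, Finset.image_id]

/-! ### The perimeter coordinate under rotation -/

/-- **The perimeter coordinate of a rotated site**: `hexPos N (ρ^i v) ≡ hexPos N v + i N (mod 6N)`. [folklore] -/
theorem hexPos_rot {N : ℕ} (hN : 1 ≤ N) {i : ℕ} (hi : i < 6) {v : Site 2} (hv : triNorm v = N) :
    hexPos N (triRotIsoPow i v) = hexPos N v + i * N ∨ hexPos N (triRotIsoPow i v) = hexPos N v + i * N - 6 * N := by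
  obtain ⟨j, hj, y, hy, hy0, rfl⟩ := exists_rot_side0 hN hv
  rw [hexPos_rot_side0 hj hy hy0, ← triRotIsoPow_add_apply]
  by_cases h : j + i < 6
  · left; rw [hexPos_rot_side0 h hy hy0]; push_cast; ring
  · right
    have e : j + i = (j + i - 6) + 6 := by omega
    rw [e, triRotIsoPow_add_six_apply, hexPos_rot_side0 (by omega) hy hy0]
    have : ((j + i - 6 : ℕ) : ℤ) = (j : ℤ) + i - 6 := by omega
    rw [this]; ring

/-- **The shifted perimeter coordinate is rotation invariant.** [folklore] -/
theorem hexShift_rot {N : ℕ} (hN : 1 ≤ N) {i : ℕ} (hi : i < 6) {u v : Site 2} (hu : triNorm u = N) (hv : triNorm v = N) :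
    hexShift N (triRotIsoPow i u) (triRotIsoPow i v) = hexShift N u v := by
  have ru := hexPos_range hN hu
  have rv := hexPos_range hN hv
  have ru' := hexPos_range hN (show triNorm (triRotIsoPow i u) = N by rw [triNorm_rot, hu])
  have rv' := hexPos_range hN (show triNorm (triRotIsoPow i v) = N by rw [triNorm_rot, hv])
  rcases hexPos_rot hN hi hu with h1 | h1 <;> rcases hexPos_rot hN hi hv with h2 | h2 <;>
    · unfold hexShift; rw [h1, h2]; split_ifs <;> omega

/-! ### Neighbours along a circle -/

/-- **`w` is the clockwise neighbour of `u` on `∂Λ_n`**: the last site anticlockwise from `u`. [folklore] -/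
def CwNb (n : ℕ) (u w : Site 2) : Prop := triNorm w = n ∧ hexShift n u w = 6 * n - 1

/-- **`w` is the anticlockwise neighbour of `u` on `∂Λ_N`**: the first site anticlockwise from `u`. [folklore] -/
def CcwNb (N : ℕ) (u w : Site 2) : Prop := triNorm w = N ∧ hexShift N u w = 1

/-- `CwNb` is rotation invariant. [folklore] -/
theorem cwNb_rot {n : ℕ} (hn : 1 ≤ n) {i : ℕ} (hi : i < 6) {u w : Site 2} (hu : triNorm u = n) (h : CwNb n u w) :
    CwNb n (triRotIsoPow i u) (triRotIsoPow i w) :=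
  ⟨by rw [triNorm_rot, h.1], by rw [hexShift_rot hn hi hu h.1, h.2]⟩

/-- `CcwNb` is rotation invariant. [folklore] -/
theorem ccwNb_rot {N : ℕ} (hN : 1 ≤ N) {i : ℕ} (hi : i < 6) {u w : Site 2} (hu : triNorm u = N) (h : CcwNb N u w) :
    CcwNb N (triRotIsoPow i u) (triRotIsoPow i w) :=
  ⟨by rw [triNorm_rot, h.1], by rw [hexShift_rot hN hi hu h.1, h.2]⟩

/-- **The shifted coordinate of a clockwise neighbour** drops by one (from any base not equal to `u`... as long as `u` is not the base). [folklore] -/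
theorem hexShift_cwNb {n : ℕ} (hn : 1 ≤ n) {s u w : Site 2} (hs : triNorm s = n) (hu : triNorm u = n) (h : CwNb n u w)
    (h1 : 1 ≤ hexShift n s u) : hexShift n s w = hexShift n s u - 1 := by
  have rs := hexPos_range hn hs
  have ru := hexPos_range hn hu
  have rw' := hexPos_range hn h.1
  have h2 := h.2
  unfold hexShift at h1 h2 ⊢
  split_ifs at h1 h2 ⊢ <;> omega

/-- **The shifted coordinate of an anticlockwise neighbour** rises by one (as long as `w` is not the base). [folklore] -/
theorem hexShift_ccwNb {N : ℕ} (hN : 1 ≤ N) {s u w : Site 2} (hs : triNorm s = N) (hu : triNorm u = N) (h : CcwNb N u w)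
    (h1 : hexShift N s u + 1 < 6 * N) : hexShift N s w = hexShift N s u + 1 := by
  have rs := hexPos_range hN hs
  have ru := hexPos_range hN hu
  have rw' := hexPos_range hN h.1
  have h2 := h.2
  unfold hexShift at h1 h2 ⊢
  split_ifs at h1 h2 ⊢ <;> omega

/-! ### Explicit points -/

/-- A site with prescribed coordinates. [folklore] -/
theorem site_eq_vec2 {v : Site 2} {a b : ℤ} (h0 : v 0 = a) (h1 : v 1 = b) : v = ![a, b] := by
  ext j; fin_cases j
  · simpa using h0
  · simpa using h1

/-! ### Hole darts of the right side -/

section Side0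

variable {G : Finset (Site 2)} {n : ℕ}

/-- **The heads of the hole darts at `(n, y)`**: `(n-1, y+1)`, and `(n-1, y)` off the corner. [folklore] -/
theorem holeHead_side0_cases {y : ℤ} {h : Site 2} (hadj : triGraph.Adj ![(n : ℤ), y] h) (hh : triNorm h < n) :
    h = ![(n : ℤ) - 1, y + 1] ∨ (h = ![(n : ℤ) - 1, y] ∧ -(n : ℤ) < y) := by
  have hlin := triNorm_lt_iff_lin.1 hh
  have hadj' := (triGraph_adj_iff_coord _ _).1 hadj
  simp only [Matrix.cons_val_zero, Matrix.cons_val_one] at hadj'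
  rcases hadj' with h' | h' | h' | h' | h' | h'
  · exfalso; omega
  · by_cases hc : -(n : ℤ) < y
    · exact Or.inr ⟨site_eq_vec2 (by omega) (by omega), hc⟩
    · exfalso; omega
  · exfalso; omega
  · exfalso; omega
  · exfalso; omega
  · exact Or.inl (site_eq_vec2 (by omega) (by omega))

/-- **The first hole dart at `(n, y)`, off the corner, steps to the second** (the left apex
`(n-1, y)` is in the hole). [folklore] -/
theorem succ_holeDart_side0_first (hG : ∀ v ∈ G, (n : ℤ) ≤ triNorm v) {y : ℤ} (hy : -(n : ℤ) < y) (hy0 : y < 0) :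
    triBdrySucc G (![(n : ℤ), y], ![(n : ℤ) - 1, y + 1]) = (![(n : ℤ), y], ![(n : ℤ) - 1, y]) := by
  have hapex : triLeftApex ![(n : ℤ), y] ![(n : ℤ) - 1, y + 1] = ![(n : ℤ) - 1, y] := by
    rw [triLeftApex_vec]; exact vec2_eq (by ring) (by ring)
  have hout : ![(n : ℤ) - 1, y] ∉ G := fun hm => by
    have h1 := hG _ hm
    have h2 : triNorm ![(n : ℤ) - 1, y] < n := triNorm_lt_iff_lin.2 (by simp; omega)
    omega
  unfold triBdrySucc; simp only; rw [hapex, if_neg hout]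

/-- **The hole dart at the corner `(n, -n)`** advances to the clockwise neighbour `(n-1, -n)`
or is blocked by it. [folklore] -/
theorem succ_holeDart_side0_corner (n : ℕ) :
    triBdrySucc G (![(n : ℤ), -(n : ℤ)], ![(n : ℤ) - 1, -(n : ℤ) + 1]) =
      if ![(n : ℤ) - 1, -(n : ℤ)] ∈ G then (![(n : ℤ) - 1, -(n : ℤ)], ![(n : ℤ) - 1, -(n : ℤ) + 1])
      else (![(n : ℤ), -(n : ℤ)], ![(n : ℤ) - 1, -(n : ℤ)]) := by
  have hapex : triLeftApex ![(n : ℤ), -(n : ℤ)] ![(n : ℤ) - 1, -(n : ℤ) + 1] = ![(n : ℤ) - 1, -(n : ℤ)] := by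
    rw [triLeftApex_vec]; exact vec2_eq (by ring) (by ring)
  unfold triBdrySucc; simp only; rw [hapex]

/-- **The second hole dart at `(n, y)`** advances to the clockwise neighbour `(n, y-1)` or is
blocked by it. [folklore] -/
theorem succ_holeDart_side0_second (y : ℤ) :
    triBdrySucc G (![(n : ℤ), y], ![(n : ℤ) - 1, y]) =
      if ![(n : ℤ), y - 1] ∈ G then (![(n : ℤ), y - 1], ![(n : ℤ) - 1, y]) else (![(n : ℤ), y], ![(n : ℤ), y - 1]) := by
  have hapex : triLeftApex ![(n : ℤ), y] ![(n : ℤ) - 1, y] = ![(n : ℤ), y - 1] := by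
    rw [triLeftApex_vec]; exact vec2_eq (by ring) (by ring)
  unfold triBdrySucc; simp only; rw [hapex]

/-- The clockwise neighbour of `(n, y)`, `-n < y < 0`, is `(n, y-1)`. [folklore] -/
theorem cwNb_side0 {y : ℤ} (hy : -(n : ℤ) < y) (hy0 : y < 0) : CwNb n ![(n : ℤ), y] ![(n : ℤ), y - 1] := by
  have h1 : triNorm ![(n : ℤ), y - 1] = n := triNorm_side0 (by omega) (by omega)
  refine ⟨h1, ?_⟩
  unfold hexShift
  rw [hexPos_side0 hy.le hy0, hexPos_side0 (by omega) (by omega)]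
  split_ifs <;> omega

/-- The clockwise neighbour of the corner `(n, -n)` is `(n-1, -n) = ρ⁵ (n, -1)`. [folklore] -/
theorem cwNb_corner (hn : 1 ≤ n) : CwNb n ![(n : ℤ), -(n : ℤ)] ![(n : ℤ) - 1, -(n : ℤ)] := by
  have e : (![(n : ℤ) - 1, -(n : ℤ)] : Site 2) = triRotIsoPow 5 ![(n : ℤ), -1] := by
    obtain ⟨-, -, -, -, -, -, -, -, -, -, r0, r1⟩ := rot_apply_formula (![(n : ℤ), -1] : Site 2)
    simp only [Matrix.cons_val_zero, Matrix.cons_val_one] at r0 r1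
    exact (site_eq_vec2 (by rw [r0]; ring) (by rw [r1])).symm
  refine ⟨?_, ?_⟩
  · rw [e, triNorm_rot]; exact triNorm_side0 (by omega) (by omega)
  · unfold hexShift
    rw [e, hexPos_rot_side0 (by norm_num) (by omega) (by omega), hexPos_side0 (by omega) (by omega)]
    split_ifs <;> push_cast at * <;> omega

/-- **The steps from a hole dart of the right side** (`G` off the hole `{|v| < n}`): from a hole
dart at `(n, y)` the traversal reaches in one or two steps (through hole darts with the same tail)
either a hole dart whose tail is the clockwise neighbour (a site of `G`), or the dart from `(n, y)`
to its clockwise neighbour (a site off `G`). [folklore] -/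
theorem holeDart_steps_side0 (hn : 1 ≤ n) (hG : ∀ v ∈ G, (n : ℤ) ≤ triNorm v) {y : ℤ} (hy : -(n : ℤ) ≤ y) (hy0 : y < 0)
    {h : Site 2} (he : (![(n : ℤ), y], h) ∈ triBdryDarts G) (hh : triNorm h < n) :
    ∃ k, (k = 1 ∨ k = 2) ∧
      (k = 2 → (triBdrySucc G (![(n : ℤ), y], h)).1 = ![(n : ℤ), y] ∧ triNorm (triBdrySucc G (![(n : ℤ), y], h)).2 < n) ∧
      (((triBdryIter G (![(n : ℤ), y], h) k).1 ∈ G ∧ CwNb n ![(n : ℤ), y] (triBdryIter G (![(n : ℤ), y], h) k).1 ∧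
          triNorm (triBdryIter G (![(n : ℤ), y], h) k).2 < n) ∨
       ((triBdryIter G (![(n : ℤ), y], h) k).1 = ![(n : ℤ), y] ∧ (triBdryIter G (![(n : ℤ), y], h) k).2 ∉ G ∧
          CwNb n ![(n : ℤ), y] (triBdryIter G (![(n : ℤ), y], h) k).2)) := by
  obtain ⟨hu, -, hadj⟩ := mem_triBdryDarts.1 he
  -- the advance-or-block step from the second dart, off the corner
  have second : ∀ {y : ℤ}, -(n : ℤ) < y → y < 0 → ![(n : ℤ), y] ∈ G →
      let f := triBdrySucc G (![(n : ℤ), y], ![(n : ℤ) - 1, y])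
      (f.1 ∈ G ∧ CwNb n ![(n : ℤ), y] f.1 ∧ triNorm f.2 < n) ∨ (f.1 = ![(n : ℤ), y] ∧ f.2 ∉ G ∧ CwNb n ![(n : ℤ), y] f.2) := by
    intro y hy hy0 hu
    have hcw := cwNb_side0 hy hy0
    have hhole : triNorm ![(n : ℤ) - 1, y] < n := triNorm_lt_iff_lin.2 (by simp; omega)
    simp only
    rw [succ_holeDart_side0_second]
    split_ifs with hw
    · exact Or.inl ⟨hw, hcw, hhole⟩
    · exact Or.inr ⟨rfl, hw, hcw⟩
  rcases holeHead_side0_cases hadj hh with rfl | ⟨rfl, hy'⟩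
  · -- first dart
    rcases hy.lt_or_eq with hy' | hy'
    · -- off the corner: one stay, then advance or block
      refine ⟨2, Or.inr rfl, fun _ => ?_, ?_⟩
      · rw [succ_holeDart_side0_first hG hy' hy0]
        exact ⟨rfl, triNorm_lt_iff_lin.2 (by simp; omega)⟩
      · show let d := triBdryIter G (![(n : ℤ), y], ![(n : ℤ) - 1, y + 1]) 2; _
        have e2 : triBdryIter G (![(n : ℤ), y], ![(n : ℤ) - 1, y + 1]) 2 = triBdrySucc G (![(n : ℤ), y], ![(n : ℤ) - 1, y]) := by
          rw [triBdryIter_two, succ_holeDart_side0_first hG hy' hy0]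
        rw [e2]
        exact second hy' hy0 hu
    · -- the corner `y = -n`
      subst hy'
      refine ⟨1, Or.inl rfl, fun h => absurd h (by norm_num), ?_⟩
      have hcw := cwNb_corner hn
      rw [triBdryIter_one, succ_holeDart_side0_corner]
      have hhole : triNorm ![(n : ℤ) - 1, -(n : ℤ) + 1] < n := triNorm_lt_iff_lin.2 (by simp; omega)
      split_ifs with hw
      · exact Or.inl ⟨hw, hcw, hhole⟩
      · exact Or.inr ⟨rfl, hw, hcw⟩
  · -- second dart: advance or block at once
    refine ⟨1, Or.inl rfl, fun h => absurd h (by norm_num), ?_⟩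
    rw [triBdryIter_one]
    exact second hy' hy0 hu

/-- **Hole darts with a common tail on the right side are consecutive**: they are the first and
the second dart, and the second follows the first. [folklore] -/
theorem holeDarts_side0_same_tail (hG : ∀ v ∈ G, (n : ℤ) ≤ triNorm v) {y : ℤ} (hy0 : y < 0)
    {h h' : Site 2} (he : (![(n : ℤ), y], h) ∈ triBdryDarts G) (hh : triNorm h < n)
    (he' : (![(n : ℤ), y], h') ∈ triBdryDarts G) (hh' : triNorm h' < n) :
    h' = h ∨ (![(n : ℤ), y], h') = triBdrySucc G (![(n : ℤ), y], h) ∨ (![(n : ℤ), y], h) = triBdrySucc G (![(n : ℤ), y], h') := by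
  obtain ⟨-, -, hadj⟩ := mem_triBdryDarts.1 he
  obtain ⟨-, -, hadj'⟩ := mem_triBdryDarts.1 he'
  rcases holeHead_side0_cases hadj hh with rfl | ⟨rfl, hy1⟩ <;>
    rcases holeHead_side0_cases hadj' hh' with rfl | ⟨rfl, hy2⟩
  · exact Or.inl rfl
  · exact Or.inr (Or.inl (by rw [succ_holeDart_side0_first hG hy2 hy0]))
  · exact Or.inr (Or.inr (by rw [succ_holeDart_side0_first hG hy1 hy0]))
  · exact Or.inl rfl

/-! ### Outside darts of the right side -/

/-- The anticlockwise neighbour of `(N, y)`, `-N ≤ y < 0`, is `(N, y+1)`. [folklore] -/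
theorem ccwNb_side0 {N : ℕ} (hN : 1 ≤ N) {y : ℤ} (hy : -(N : ℤ) ≤ y) (hy0 : y < 0) : CcwNb N ![(N : ℤ), y] ![(N : ℤ), y + 1] := by
  rcases lt_or_eq_of_le (show y + 1 ≤ 0 by omega) with h1 | h1
  · refine ⟨triNorm_side0 (by omega) h1.le, ?_⟩
    unfold hexShift
    rw [hexPos_side0 hy hy0, hexPos_side0 (by omega) h1]
    split_ifs <;> omega
  · have e : (![(N : ℤ), y + 1] : Site 2) = triRotIsoPow 1 ![(N : ℤ), -(N : ℤ)] := by
      obtain ⟨-, -, r0, r1, -⟩ := rot_apply_formula (![(N : ℤ), -(N : ℤ)] : Site 2)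
      simp only [Matrix.cons_val_zero, Matrix.cons_val_one] at r0 r1
      exact (site_eq_vec2 (by rw [r0]; ring) (by rw [r1]; omega)).symm
    refine ⟨?_, ?_⟩
    · rw [e, triNorm_rot]; exact triNorm_side0 (by omega) (by omega)
    · unfold hexShift
      rw [e, hexPos_rot_side0 (by norm_num) (by omega) (by omega), hexPos_side0 hy hy0]
      split_ifs <;> push_cast at * <;> omega

/-- **The outside dart `(N, y) → (N+1, y)`** advances to the anticlockwise neighbour `(N, y+1)` or
is blocked by it. [folklore] -/
theorem succ_outDart_side0_adv {N : ℕ} (y : ℤ) :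
    triBdrySucc G (![(N : ℤ), y], ![(N : ℤ) + 1, y]) =
      if ![(N : ℤ), y + 1] ∈ G then (![(N : ℤ), y + 1], ![(N : ℤ) + 1, y]) else (![(N : ℤ), y], ![(N : ℤ), y + 1]) := by
  have hapex : triLeftApex ![(N : ℤ), y] ![(N : ℤ) + 1, y] = ![(N : ℤ), y + 1] := by
    rw [triLeftApex_vec]; exact vec2_eq (by ring) (by ring)
  unfold triBdrySucc; simp only; rw [hapex]

/-- **The outside dart `(N, y) → (N+1, y-1)` stays**: its successor is `(N, y) → (N+1, y)`. [folklore] -/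
theorem succ_outDart_side0_stay {N : ℕ} (hG : ∀ v ∈ G, triNorm v ≤ (N : ℤ)) (y : ℤ) :
    triBdrySucc G (![(N : ℤ), y], ![(N : ℤ) + 1, y - 1]) = (![(N : ℤ), y], ![(N : ℤ) + 1, y]) := by
  have hapex : triLeftApex ![(N : ℤ), y] ![(N : ℤ) + 1, y - 1] = ![(N : ℤ) + 1, y] := by
    rw [triLeftApex_vec]; exact vec2_eq (by ring) (by ring)
  have hout : ![(N : ℤ) + 1, y] ∉ G := fun hm => by
    have h1 := hG _ hm
    have h2 : (N : ℤ) < triNorm ![(N : ℤ) + 1, y] := lt_triNorm_iff_lin.2 (Or.inl (by simp))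
    omega
  unfold triBdrySucc; simp only; rw [hapex, if_neg hout]

/-- **The extra outside dart at the corner `(N, -N) → (N, -N-1)` stays**: its successor is
`(N, -N) → (N+1, -N-1)`. [folklore] -/
theorem succ_outDart_side0_corner {N : ℕ} (hG : ∀ v ∈ G, triNorm v ≤ (N : ℤ)) :
    triBdrySucc G (![(N : ℤ), -(N : ℤ)], ![(N : ℤ), -(N : ℤ) - 1]) = (![(N : ℤ), -(N : ℤ)], ![(N : ℤ) + 1, -(N : ℤ) - 1]) := by
  have hapex : triLeftApex ![(N : ℤ), -(N : ℤ)] ![(N : ℤ), -(N : ℤ) - 1] = ![(N : ℤ) + 1, -(N : ℤ) - 1] := by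
    rw [triLeftApex_vec]; exact vec2_eq (by ring) (by ring)
  have hout : ![(N : ℤ) + 1, -(N : ℤ) - 1] ∉ G := fun hm => by
    have h1 := hG _ hm
    have h2 : (N : ℤ) < triNorm ![(N : ℤ) + 1, -(N : ℤ) - 1] := lt_triNorm_iff_lin.2 (Or.inl (by simp))
    omega
  unfold triBdrySucc; simp only; rw [hapex, if_neg hout]

/-- **The steps from an outside dart of the right side** (`G ⊆ Λ_N`): within one to three steps
(through outside darts with the same tail) the traversal reaches either an outside dart whose tail
is the anticlockwise neighbour (a site of `G`), or the dart from `(N, y)` to its anticlockwise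
neighbour (a site off `G`). [folklore] -/
theorem outDart_steps_side0 {N : ℕ} (hN : 1 ≤ N) (hG : ∀ v ∈ G, triNorm v ≤ (N : ℤ)) {y : ℤ} (hy : -(N : ℤ) ≤ y) (hy0 : y < 0)
    {o : Site 2} (he : (![(N : ℤ), y], o) ∈ triBdryDarts G) (ho : (N : ℤ) < triNorm o) :
    ∃ k, (k = 1 ∨ k = 2 ∨ k = 3) ∧
      (∀ j, 1 ≤ j → j < k → (triBdryIter G (![(N : ℤ), y], o) j).1 = ![(N : ℤ), y] ∧
        (N : ℤ) < triNorm (triBdryIter G (![(N : ℤ), y], o) j).2) ∧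
      (((triBdryIter G (![(N : ℤ), y], o) k).1 ∈ G ∧ CcwNb N ![(N : ℤ), y] (triBdryIter G (![(N : ℤ), y], o) k).1 ∧
          (N : ℤ) < triNorm (triBdryIter G (![(N : ℤ), y], o) k).2) ∨
       ((triBdryIter G (![(N : ℤ), y], o) k).1 = ![(N : ℤ), y] ∧ (triBdryIter G (![(N : ℤ), y], o) k).2 ∉ G ∧
          CcwNb N ![(N : ℤ), y] (triBdryIter G (![(N : ℤ), y], o) k).2)) := by
  obtain ⟨hu, -, hadj⟩ := mem_triBdryDarts.1 he
  have hccw := ccwNb_side0 hN hy hy0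
  have hov : o ∉ triBall N := by rw [mem_triBall_iff, not_le]; exact ho
  have hout1 : (N : ℤ) < triNorm ![(N : ℤ) + 1, y] := lt_triNorm_iff_lin.2 (Or.inl (by simp))
  have adv : let f := triBdrySucc G (![(N : ℤ), y], ![(N : ℤ) + 1, y])
      (f.1 ∈ G ∧ CcwNb N ![(N : ℤ), y] f.1 ∧ (N : ℤ) < triNorm f.2) ∨ (f.1 = ![(N : ℤ), y] ∧ f.2 ∉ G ∧ CcwNb N ![(N : ℤ), y] f.2) := by
    simp only
    rw [succ_outDart_side0_adv]
    split_ifs with hw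
    · exact Or.inl ⟨hw, hccw, hout1⟩
    · exact Or.inr ⟨rfl, hw, hccw⟩
  rcases side0_out_cases hy hy0 hadj hov with rfl | rfl | ⟨hc, rfl⟩
  · refine ⟨1, Or.inl rfl, fun j h1 h2 => by omega, ?_⟩
    rw [triBdryIter_one]; exact adv
  · refine ⟨2, Or.inr (Or.inl rfl), fun j h1 h2 => ?_, ?_⟩
    · have : j = 1 := by omega
      subst this
      rw [triBdryIter_one, succ_outDart_side0_stay hG]
      exact ⟨rfl, hout1⟩
    · rw [triBdryIter_two, succ_outDart_side0_stay hG]; exact adv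
  · subst hc
    refine ⟨3, Or.inr (Or.inr rfl), fun j h1 h2 => ?_, ?_⟩
    · have e1 : triBdryIter G (![(N : ℤ), -(N : ℤ)], ![(N : ℤ), -(N : ℤ) - 1]) 1 = (![(N : ℤ), -(N : ℤ)], ![(N : ℤ) + 1, -(N : ℤ) - 1]) := by
        rw [triBdryIter_one, succ_outDart_side0_corner hG]
      have e2 : triBdryIter G (![(N : ℤ), -(N : ℤ)], ![(N : ℤ), -(N : ℤ) - 1]) 2 = (![(N : ℤ), -(N : ℤ)], ![(N : ℤ) + 1, -(N : ℤ)]) := by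
        rw [triBdryIter_two, succ_outDart_side0_corner hG, succ_outDart_side0_stay hG]
      have hout2 : (N : ℤ) < triNorm ![(N : ℤ) + 1, -(N : ℤ) - 1] := lt_triNorm_iff_lin.2 (Or.inl (by simp))
      rcases (show j = 1 ∨ j = 2 by omega) with rfl | rfl
      · rw [e1]; exact ⟨rfl, hout2⟩
      · rw [e2]; exact ⟨rfl, by simpa using hout1⟩
    · have e3 : triBdryIter G (![(N : ℤ), -(N : ℤ)], ![(N : ℤ), -(N : ℤ) - 1]) 3 =
          triBdrySucc G (![(N : ℤ), -(N : ℤ)], ![(N : ℤ) + 1, -(N : ℤ)]) := by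
        show triBdrySucc G (triBdrySucc G (triBdrySucc G _)) = _
        rw [succ_outDart_side0_corner hG, succ_outDart_side0_stay hG]
      rw [e3]
      simpa using adv

/-- **Outside darts with a common tail on the right side are within two steps of one another.** [folklore] -/
theorem outDarts_side0_same_tail {N : ℕ} (hG : ∀ v ∈ G, triNorm v ≤ (N : ℤ)) {y : ℤ} (hy : -(N : ℤ) ≤ y) (hy0 : y < 0)
    {o o' : Site 2} (he : (![(N : ℤ), y], o) ∈ triBdryDarts G) (ho : (N : ℤ) < triNorm o)
    (he' : (![(N : ℤ), y], o') ∈ triBdryDarts G) (ho' : (N : ℤ) < triNorm o') :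
    ∃ j ≤ 2, (![(N : ℤ), y], o') = triBdryIter G (![(N : ℤ), y], o) j ∨ (![(N : ℤ), y], o) = triBdryIter G (![(N : ℤ), y], o') j := by
  obtain ⟨-, -, hadj⟩ := mem_triBdryDarts.1 he
  obtain ⟨-, -, hadj'⟩ := mem_triBdryDarts.1 he'
  have hov : o ∉ triBall N := by rw [mem_triBall_iff, not_le]; exact ho
  have hov' : o' ∉ triBall N := by rw [mem_triBall_iff, not_le]; exact ho'
  have s1 := succ_outDart_side0_stay (G := G) hG y
  have s2 := succ_outDart_side0_corner (G := G) hG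
  rcases side0_out_cases hy hy0 hadj hov with rfl | rfl | ⟨hc, rfl⟩ <;>
    rcases side0_out_cases hy hy0 hadj' hov' with rfl | rfl | ⟨hc', rfl⟩
  · exact ⟨0, by norm_num, Or.inl rfl⟩
  · exact ⟨1, by norm_num, Or.inr (by rw [triBdryIter_one, s1])⟩
  · subst hc'; exact ⟨2, le_rfl, Or.inr (by rw [triBdryIter_two, s2, s1])⟩
  · exact ⟨1, by norm_num, Or.inl (by rw [triBdryIter_one, s1])⟩
  · exact ⟨0, by norm_num, Or.inl rfl⟩
  · subst hc'; exact ⟨1, by norm_num, Or.inr (by rw [triBdryIter_one, s2])⟩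
  · subst hc; exact ⟨2, le_rfl, Or.inl (by rw [triBdryIter_two, s2, s1])⟩
  · subst hc; exact ⟨1, by norm_num, Or.inl (by rw [triBdryIter_one, s2])⟩
  · exact ⟨0, by norm_num, Or.inl rfl⟩

end Side0

/-! ### The steps from hole darts and outside darts, anywhere on the circles -/

section General

variable {G : Finset (Site 2)}

/-- **Rotating a dart of the circle to the right side**: the data of the rotated set. [folklore] -/
theorem exists_rot_setup {K : ℕ} (hK : 1 ≤ K) {e : Site 2 × Site 2} (hu : triNorm e.1 = K) :
    ∃ i < 6, ∃ y : ℤ, -(K : ℤ) ≤ y ∧ y < 0 ∧ ∃ (G₀ : Finset (Site 2)) (h₀ : Site 2),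
      G₀.image (triRotIsoPow i) = G ∧ e = (triRotIsoPow i ![(K : ℤ), y], triRotIsoPow i h₀) ∧
      (∀ v, v ∈ G₀ ↔ triRotIsoPow i v ∈ G) ∧ triNorm h₀ = triNorm e.2 ∧
      (∀ j, triBdryIter G e j = (triRotIsoPow i (triBdryIter G₀ (![(K : ℤ), y], h₀) j).1,
        triRotIsoPow i (triBdryIter G₀ (![(K : ℤ), y], h₀) j).2)) ∧
      (e ∈ triBdryDarts G → (![(K : ℤ), y], h₀) ∈ triBdryDarts G₀) := by
  obtain ⟨i, hi, y, hy, hy0, hu'⟩ := exists_rot_side0 hK hu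
  set G₀ := G.image (triRotIsoPow (6 - i)) with hG₀
  have hGG : G₀.image (triRotIsoPow i) = G := image_rot_image_rot_six_sub i hi.le G
  set h₀ := triRotIsoPow (6 - i) e.2 with hh₀
  have he2 : e.2 = triRotIsoPow i h₀ := (rot_rot_six_sub i hi.le e.2).symm
  have hee : e = (triRotIsoPow i ![(K : ℤ), y], triRotIsoPow i h₀) := Prod.ext hu' he2
  have hmem : ∀ v, v ∈ G₀ ↔ triRotIsoPow i v ∈ G := fun v => by rw [← hGG]; exact (mem_image_rot_iff i G₀ v).symm
  refine ⟨i, hi, y, hy, hy0, G₀, h₀, hGG, hee, hmem, by rw [hh₀, triNorm_rot], fun j => ?_, fun he => ?_⟩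
  · rw [hee, ← hGG]; exact triBdryIter_image_rot i G₀ (![(K : ℤ), y], h₀) j
  · rw [← mem_triBdryDarts_image_rot i, hGG, ← hee]; exact he

/-- **The steps from a hole dart** (`G` off the hole `{|v| < n}`, `n ≥ 1`): from a boundary dart
`e` of `G` with tail on `∂Λ_n` and head in the hole, the traversal reaches in one or two steps
(through hole darts with the same tail) either a hole dart whose tail is the CLOCKWISE neighbour of
the tail (a site of `G`), or the dart from the tail to its clockwise neighbour (a site off `G`). [folklore] -/
theorem holeDart_steps {n : ℕ} (hn : 1 ≤ n) (hG : ∀ v ∈ G, (n : ℤ) ≤ triNorm v)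
    {e : Site 2 × Site 2} (he : e ∈ triBdryDarts G) (hu : triNorm e.1 = n) (hh : triNorm e.2 < n) :
    ∃ k, (k = 1 ∨ k = 2) ∧ (k = 2 → (triBdrySucc G e).1 = e.1 ∧ triNorm (triBdrySucc G e).2 < n) ∧
      (((triBdryIter G e k).1 ∈ G ∧ CwNb n e.1 (triBdryIter G e k).1 ∧ triNorm (triBdryIter G e k).2 < n) ∨
       ((triBdryIter G e k).1 = e.1 ∧ (triBdryIter G e k).2 ∉ G ∧ CwNb n e.1 (triBdryIter G e k).2)) := by
  obtain ⟨i, hi, y, hy, hy0, G₀, h₀, hGG, hee, hmem, hnorm, hiter, hdart⟩ := exists_rot_setup (G := G) hn hu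
  have hG₀ : ∀ v ∈ G₀, (n : ℤ) ≤ triNorm v := fun v hv => by have := hG _ ((hmem v).1 hv); rwa [triNorm_rot] at this
  have he₀ := hdart he
  have hh₀ : triNorm h₀ < n := by rw [hnorm]; exact hh
  obtain ⟨k, hk, hstay, hcases⟩ := holeDart_steps_side0 hn hG₀ hy hy0 he₀ hh₀
  have hun : triNorm (![(n : ℤ), y] : Site 2) = n := triNorm_side0 hy hy0.le
  have hinj := (triRotIsoPow i).injective
  have he1 : e.1 = triRotIsoPow i ![(n : ℤ), y] := by rw [hee]
  refine ⟨k, hk, fun h2 => ?_, ?_⟩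
  · obtain ⟨a, b⟩ := hstay h2
    rw [← triBdryIter_one, hiter 1, he1]
    refine ⟨by rw [triBdryIter_one, a], by rw [triNorm_rot, triBdryIter_one]; exact b⟩
  · rw [hiter k, he1]
    rcases hcases with ⟨h1, h2, h3⟩ | ⟨h1, h2, h3⟩
    · exact Or.inl ⟨(hmem _).1 h1, cwNb_rot hn hi hun h2, by rw [triNorm_rot]; exact h3⟩
    · exact Or.inr ⟨by rw [h1], fun hm => h2 ((hmem _).2 hm), cwNb_rot hn hi hun h3⟩

/-- **Hole darts with a common tail are consecutive.** [folklore] -/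
theorem holeDarts_same_tail {n : ℕ} (hn : 1 ≤ n) (hG : ∀ v ∈ G, (n : ℤ) ≤ triNorm v)
    {e e' : Site 2 × Site 2} (he : e ∈ triBdryDarts G) (hu : triNorm e.1 = n) (hh : triNorm e.2 < n)
    (he' : e' ∈ triBdryDarts G) (htail : e'.1 = e.1) (hh' : triNorm e'.2 < n) :
    e' = e ∨ e' = triBdrySucc G e ∨ e = triBdrySucc G e' := by
  obtain ⟨i, hi, y, hy, hy0, G₀, h₀, hGG, hee, hmem, hnorm, hiter, hdart⟩ := exists_rot_setup (G := G) hn hu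
  have hG₀ : ∀ v ∈ G₀, (n : ℤ) ≤ triNorm v := fun v hv => by have := hG _ ((hmem v).1 hv); rwa [triNorm_rot] at this
  have he₀ := hdart he
  have hh₀ : triNorm h₀ < n := by rw [hnorm]; exact hh
  set h₀' := triRotIsoPow (6 - i) e'.2 with hh₀'
  have he2' : e'.2 = triRotIsoPow i h₀' := (rot_rot_six_sub i hi.le e'.2).symm
  have hee' : e' = (triRotIsoPow i ![(n : ℤ), y], triRotIsoPow i h₀') := by
    refine Prod.ext ?_ he2'
    rw [htail, hee]
  have he₀' : (![(n : ℤ), y], h₀') ∈ triBdryDarts G₀ := by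
    rw [← mem_triBdryDarts_image_rot i, hGG, ← hee']; exact he'
  have hh₀'n : triNorm h₀' < n := by rw [hh₀', triNorm_rot]; exact hh'
  have hsucc : ∀ h : Site 2, triBdrySucc G (triRotIsoPow i ![(n : ℤ), y], triRotIsoPow i h) =
      (triRotIsoPow i (triBdrySucc G₀ (![(n : ℤ), y], h)).1, triRotIsoPow i (triBdrySucc G₀ (![(n : ℤ), y], h)).2) := by
    intro h; rw [← hGG]; exact triBdrySucc_image_rot i G₀ _ h
  rcases holeDarts_side0_same_tail hG₀ hy0 he₀ hh₀ he₀' hh₀'n with h | h | h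
  · left; rw [hee', hee, h]
  · right; left
    rw [hee', hee, hsucc, ← h]
  · right; right
    rw [hee', hee, hsucc, ← h]

/-- **The steps from an outside dart** (`G ⊆ Λ_N`, `N ≥ 1`): from a boundary dart `e` of `G` with
tail on `∂Λ_N` and head outside `Λ_N`, the traversal reaches within one to three steps (through
outside darts with the same tail) either an outside dart whose tail is the ANTICLOCKWISE neighbour
of the tail (a site of `G`), or the dart from the tail to its anticlockwise neighbour (a site off `G`). [folklore] -/
theorem outDart_steps {N : ℕ} (hN : 1 ≤ N) (hG : ∀ v ∈ G, triNorm v ≤ (N : ℤ))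
    {e : Site 2 × Site 2} (he : e ∈ triBdryDarts G) (hu : triNorm e.1 = N) (ho : (N : ℤ) < triNorm e.2) :
    ∃ k, (k = 1 ∨ k = 2 ∨ k = 3) ∧
      (∀ j, 1 ≤ j → j < k → (triBdryIter G e j).1 = e.1 ∧ (N : ℤ) < triNorm (triBdryIter G e j).2) ∧
      (((triBdryIter G e k).1 ∈ G ∧ CcwNb N e.1 (triBdryIter G e k).1 ∧ (N : ℤ) < triNorm (triBdryIter G e k).2) ∨
       ((triBdryIter G e k).1 = e.1 ∧ (triBdryIter G e k).2 ∉ G ∧ CcwNb N e.1 (triBdryIter G e k).2)) := by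
  obtain ⟨i, hi, y, hy, hy0, G₀, h₀, hGG, hee, hmem, hnorm, hiter, hdart⟩ := exists_rot_setup (G := G) hN hu
  have hG₀ : ∀ v ∈ G₀, triNorm v ≤ (N : ℤ) := fun v hv => by have := hG _ ((hmem v).1 hv); rwa [triNorm_rot] at this
  have he₀ := hdart he
  have hh₀ : (N : ℤ) < triNorm h₀ := by rw [hnorm]; exact ho
  obtain ⟨k, hk, hstay, hcases⟩ := outDart_steps_side0 hN hG₀ hy hy0 he₀ hh₀
  have hun : triNorm (![(N : ℤ), y] : Site 2) = N := triNorm_side0 hy hy0.le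
  have he1 : e.1 = triRotIsoPow i ![(N : ℤ), y] := by rw [hee]
  refine ⟨k, hk, fun j h1 h2 => ?_, ?_⟩
  · obtain ⟨a, b⟩ := hstay j h1 h2
    rw [hiter j, he1]
    exact ⟨by rw [a], by rw [triNorm_rot]; exact b⟩
  · rw [hiter k, he1]
    rcases hcases with ⟨h1, h2, h3⟩ | ⟨h1, h2, h3⟩
    · exact Or.inl ⟨(hmem _).1 h1, ccwNb_rot hN hi hun h2, by rw [triNorm_rot]; exact h3⟩
    · exact Or.inr ⟨by rw [h1], fun hm => h2 ((hmem _).2 hm), ccwNb_rot hN hi hun h3⟩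

/-- **Outside darts with a common tail are within two steps of one another.** [folklore] -/
theorem outDarts_same_tail {N : ℕ} (hN : 1 ≤ N) (hG : ∀ v ∈ G, triNorm v ≤ (N : ℤ))
    {e e' : Site 2 × Site 2} (he : e ∈ triBdryDarts G) (hu : triNorm e.1 = N) (ho : (N : ℤ) < triNorm e.2)
    (he' : e' ∈ triBdryDarts G) (htail : e'.1 = e.1) (ho' : (N : ℤ) < triNorm e'.2) :
    ∃ j ≤ 2, e' = triBdryIter G e j ∨ e = triBdryIter G e' j := by
  obtain ⟨i, hi, y, hy, hy0, G₀, h₀, hGG, hee, hmem, hnorm, hiter, hdart⟩ := exists_rot_setup (G := G) hN hu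
  have hG₀ : ∀ v ∈ G₀, triNorm v ≤ (N : ℤ) := fun v hv => by have := hG _ ((hmem v).1 hv); rwa [triNorm_rot] at this
  have he₀ := hdart he
  have hh₀ : (N : ℤ) < triNorm h₀ := by rw [hnorm]; exact ho
  set h₀' := triRotIsoPow (6 - i) e'.2 with hh₀'
  have he2' : e'.2 = triRotIsoPow i h₀' := (rot_rot_six_sub i hi.le e'.2).symm
  have hee' : e' = (triRotIsoPow i ![(N : ℤ), y], triRotIsoPow i h₀') := by
    refine Prod.ext ?_ he2'
    rw [htail, hee]
  have he₀' : (![(N : ℤ), y], h₀') ∈ triBdryDarts G₀ := by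
    rw [← mem_triBdryDarts_image_rot i, hGG, ← hee']; exact he'
  have hh₀'n : (N : ℤ) < triNorm h₀' := by rw [hh₀', triNorm_rot]; exact ho'
  have hiter' : ∀ (h : Site 2) (j : ℕ), triBdryIter G (triRotIsoPow i ![(N : ℤ), y], triRotIsoPow i h) j =
      (triRotIsoPow i (triBdryIter G₀ (![(N : ℤ), y], h) j).1, triRotIsoPow i (triBdryIter G₀ (![(N : ℤ), y], h) j).2) := by
    intro h j; rw [← hGG]; exact triBdryIter_image_rot i G₀ (![(N : ℤ), y], h) j
  obtain ⟨j, hj, h⟩ := outDarts_side0_same_tail hG₀ hy hy0 he₀ hh₀ he₀' hh₀'n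
  refine ⟨j, hj, ?_⟩
  rcases h with h | h
  · left; rw [hee', hee, hiter', ← h]
  · right; rw [hee', hee, hiter', ← h]

end General



/-! ### Sweeping a circle along the boundary traversal -/

section Sweep

variable {G : Finset (Site 2)}

/-- A **hole dart** of `G` at level `n`: a boundary dart with tail on `∂Λ_n` and head in the hole `{|v| < n}`. [folklore] -/
def HoleDart (G : Finset (Site 2)) (n : ℕ) (d : Site 2 × Site 2) : Prop :=
  d ∈ triBdryDarts G ∧ triNorm d.1 = n ∧ triNorm d.2 < n

/-- An **outside dart** of `G` at level `N`: a boundary dart with tail on `∂Λ_N` and head outside `Λ_N`. [folklore] -/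
def OutDart (G : Finset (Site 2)) (N : ℕ) (d : Site 2 × Site 2) : Prop :=
  d ∈ triBdryDarts G ∧ triNorm d.1 = N ∧ (N : ℤ) < triNorm d.2

/-- **Tails along the traversal form a path.** [folklore] -/
theorem pathIn_iter_tails {d : Site 2 × Site 2} (hd : d ∈ triBdryDarts G) (k : ℕ) :
    PathIn triGraph {v : Site 2 | ∃ j ≤ k, (triBdryIter G d j).1 = v} d.1 (triBdryIter G d k).1 := by
  induction k with
  | zero => exact PathIn.refl ⟨0, le_rfl, rfl⟩
  | succ k ih =>
    have ih' : PathIn triGraph {v : Site 2 | ∃ j ≤ k + 1, (triBdryIter G d j).1 = v} d.1 (triBdryIter G d k).1 :=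
      ih.mono fun v hv => by obtain ⟨j, hj, hv⟩ := hv; exact ⟨j, by omega, hv⟩
    have hmemk : (triBdryIter G d (k + 1)).1 ∈ {v : Site 2 | ∃ j ≤ k + 1, (triBdryIter G d j).1 = v} := ⟨k + 1, le_rfl, rfl⟩
    obtain ⟨-, -, hadj⟩ := mem_triBdryDarts.1 (triBdryIter_mem hd k)
    rw [triBdryIter_succ]
    rcases fst_triBdrySucc_eq_or_adj G hadj with e | hadj'
    · rw [e]; exact ih'
    · rw [triBdryIter_succ] at hmemk
      exact ih'.tail hadj' hmemk

/-- **The hole darts sweep the inner circle clockwise** (`G` off the hole, containing every site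
of `∂Λ_n` at positive shifted coordinate from `s`): from a hole dart whose tail has shifted
coordinate `t`, every value `t' ∈ [1, t]` is attained by the tail of a hole dart at most `2 (t - t')`
steps later, through hole darts only. [folklore] -/
theorem hole_sweep {n : ℕ} (hn : 1 ≤ n) (hG : ∀ v ∈ G, (n : ℤ) ≤ triNorm v) {s : Site 2} (hs : triNorm s = n)
    (hfree : ∀ w : Site 2, triNorm w = n → 1 ≤ hexShift n s w → w ∈ G) :
    ∀ (m : ℕ) {e : Site 2 × Site 2}, HoleDart G n e → ∀ t' : ℤ, 1 ≤ t' → t' ≤ hexShift n s e.1 →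
      hexShift n s e.1 - t' ≤ m →
      ∃ k ≤ 2 * m, HoleDart G n (triBdryIter G e k) ∧ hexShift n s (triBdryIter G e k).1 = t' ∧
        ∀ j ≤ k, HoleDart G n (triBdryIter G e j) := by
  intro m
  induction m with
  | zero =>
    intro e he t' h1 h2 h3
    exact ⟨0, le_rfl, he, by rw [triBdryIter_zero]; omega, fun j hj => by rw [Nat.le_zero.1 hj]; exact he⟩
  | succ m ih =>
    intro e he t' h1 h2 h3
    rcases eq_or_lt_of_le h2 with heq | hlt
    · exact ⟨0, by omega, he, by rw [triBdryIter_zero, heq], fun j hj => by rw [Nat.le_zero.1 hj]; exact he⟩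
    obtain ⟨k₀, hk₀, hstay, hcases⟩ := holeDart_steps hn hG he.1 he.2.1 he.2.2
    -- the blocked case does not occur: the clockwise neighbour is a free site
    have hte : 1 ≤ hexShift n s e.1 := by omega
    rcases hcases with ⟨hf1, hcw, hf2⟩ | ⟨-, hf2, hcw⟩
    swap
    · exfalso
      have hsh := hexShift_cwNb hn hs he.2.1 hcw hte
      exact hf2 (hfree _ hcw.1 (by omega))
    set f := triBdryIter G e k₀ with hf
    have hfH : HoleDart G n f := ⟨triBdryIter_mem he.1 k₀, hcw.1, hf2⟩
    have hsh : hexShift n s f.1 = hexShift n s e.1 - 1 := hexShift_cwNb hn hs he.2.1 hcw hte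
    obtain ⟨k₁, hk₁, hH, hval, hall⟩ := ih hfH t' h1 (by rw [hsh]; omega) (by rw [hsh]; omega)
    refine ⟨k₀ + k₁, by rcases hk₀ with rfl | rfl <;> omega, ?_, ?_, fun j hj => ?_⟩
    · rw [triBdryIter_add]; exact hH
    · rw [triBdryIter_add]; exact hval
    · by_cases hjk : k₀ ≤ j
      · obtain ⟨j', rfl⟩ := Nat.exists_eq_add_of_le hjk
        rw [triBdryIter_add]; exact hall j' (by omega)
      · rcases (show j = 0 ∨ (j = 1 ∧ k₀ = 2) by rcases hk₀ with rfl | rfl <;> omega) with rfl | ⟨rfl, hk2⟩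
        · exact he
        · obtain ⟨a, b⟩ := hstay hk2
          rw [triBdryIter_one]
          exact ⟨by rw [← triBdryIter_one]; exact triBdryIter_mem he.1 1, by rw [a]; exact he.2.1, b⟩

/-- **The outside darts sweep the outer circle anticlockwise** (`G ⊆ Λ_N`, containing every site
of `∂Λ_N` at positive shifted coordinate from `s`): from an outside dart whose tail has shifted
coordinate `T`, every value `T' ∈ [T, 6N)` is attained by the tail of an outside dart at most
`3 (T' - T)` steps later, through outside darts with tails of shifted coordinate in `[T, T']`. [folklore] -/
theorem out_sweep {N : ℕ} (hN : 1 ≤ N) (hG : ∀ v ∈ G, triNorm v ≤ (N : ℤ)) {s : Site 2} (hs : triNorm s = N)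
    (hfree : ∀ w : Site 2, triNorm w = N → 1 ≤ hexShift N s w → w ∈ G) :
    ∀ (m : ℕ) {e : Site 2 × Site 2}, OutDart G N e → ∀ T' : ℤ, hexShift N s e.1 ≤ T' → T' < 6 * N →
      T' - hexShift N s e.1 ≤ m →
      ∃ k ≤ 3 * m, OutDart G N (triBdryIter G e k) ∧ hexShift N s (triBdryIter G e k).1 = T' ∧
        ∀ j ≤ k, OutDart G N (triBdryIter G e j) ∧ hexShift N s e.1 ≤ hexShift N s (triBdryIter G e j).1 ∧
          hexShift N s (triBdryIter G e j).1 ≤ T' := by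
  intro m
  induction m with
  | zero =>
    intro e he T' h1 h2 h3
    refine ⟨0, le_rfl, he, by rw [triBdryIter_zero]; omega, fun j hj => ?_⟩
    rw [Nat.le_zero.1 hj, triBdryIter_zero]; exact ⟨he, le_rfl, h1⟩
  | succ m ih =>
    intro e he T' h1 h2 h3
    rcases eq_or_lt_of_le h1 with heq | hlt
    · refine ⟨0, by omega, he, by rw [triBdryIter_zero, heq], fun j hj => ?_⟩
      rw [Nat.le_zero.1 hj, triBdryIter_zero]; exact ⟨he, le_rfl, h1⟩
    obtain ⟨k₀, hk₀, hstay, hcases⟩ := outDart_steps hN hG he.1 he.2.1 he.2.2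
    have hte : hexShift N s e.1 + 1 < 6 * N := by omega
    rcases hcases with ⟨hf1, hccw, hf2⟩ | ⟨-, hf2, hccw⟩
    swap
    · exfalso
      have hsh := hexShift_ccwNb hN hs he.2.1 hccw hte
      have h0 := (hexShift_range hN hs he.2.1).1
      exact hf2 (hfree _ hccw.1 (by omega))
    set f := triBdryIter G e k₀ with hf
    have hfO : OutDart G N f := ⟨triBdryIter_mem he.1 k₀, hccw.1, hf2⟩
    have hsh : hexShift N s f.1 = hexShift N s e.1 + 1 := hexShift_ccwNb hN hs he.2.1 hccw hte
    obtain ⟨k₁, hk₁, hO, hval, hall⟩ := ih hfO T' (by rw [hsh]; omega) h2 (by rw [hsh]; omega)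
    refine ⟨k₀ + k₁, by rcases hk₀ with rfl | rfl | rfl <;> omega, ?_, ?_, fun j hj => ?_⟩
    · rw [triBdryIter_add]; exact hO
    · rw [triBdryIter_add]; exact hval
    · by_cases hjk : k₀ ≤ j
      · obtain ⟨j', rfl⟩ := Nat.exists_eq_add_of_le hjk
        obtain ⟨a, b, c⟩ := hall j' (by omega)
        rw [triBdryIter_add, ← hf]
        exact ⟨a, by omega, c⟩
      · rcases Nat.eq_zero_or_pos j with rfl | hj0
        · rw [triBdryIter_zero]; exact ⟨he, le_rfl, h1⟩
        · obtain ⟨a, b⟩ := hstay j hj0 (by omega)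
          refine ⟨⟨triBdryIter_mem he.1 j, by rw [a]; exact he.2.1, b⟩, by rw [a], by rw [a]; exact h1⟩

/-- **Shifting the origin of the shifted coordinate.** [folklore] -/
theorem hexShift_rebase {K : ℕ} (hK : 1 ≤ K) {u v w : Site 2} (hu : triNorm u = K) (hv : triNorm v = K) (hw : triNorm w = K) :
    hexShift K v w = hexShift K u w - hexShift K u v ∨ hexShift K v w = hexShift K u w - hexShift K u v + 6 * K := by
  have ru := hexPos_range hK hu
  have rv := hexPos_range hK hv
  have rw' := hexPos_range hK hw
  unfold hexShift; split_ifs <;> omega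

/-- **Anticlockwise arcs of a circle**: from `u` to `v` inside the sites of `∂Λ_K` of shifted
coordinate (from `u`) at most that of `v`. [folklore] -/
theorem pathIn_sphere_arc {K : ℕ} (hK : 1 ≤ K) {u v : Site 2} (hu : triNorm u = K) (hv : triNorm v = K) :
    PathIn triGraph {w : Site 2 | triNorm w = K ∧ hexShift K u w ≤ hexShift K u v} u v := by
  obtain ⟨o, hadj, ho⟩ := exists_adj_triNorm_eq_add_one u
  have ho' : (K : ℤ) < triNorm o := by omega
  have he : OutDart (triBall K) K (u, o) :=
    ⟨mem_triBdryDarts.2 ⟨mem_triBall_iff.2 hu.le, fun h => by have h' : triNorm o ≤ (K : ℤ) := mem_triBall_iff.1 h; omega, hadj⟩,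
      hu, ho'⟩
  have hG : ∀ v ∈ triBall K, triNorm v ≤ (K : ℤ) := fun v hv => mem_triBall_iff.1 hv
  have hfree : ∀ w : Site 2, triNorm w = K → 1 ≤ hexShift K u w → w ∈ triBall K := fun w hw _ => mem_triBall_iff.2 hw.le
  have hr := hexShift_range hK hu hv
  obtain ⟨k, -, hO, hval, hall⟩ := out_sweep hK hG hu hfree (hexShift K u v).toNat he (hexShift K u v)
    (by show hexShift K u u ≤ _; rw [hexShift_self]; exact hr.1) hr.2 (by show hexShift K u v - hexShift K u u ≤ _; rw [hexShift_self]; omega)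
  have hend : (triBdryIter (triBall K) (u, o) k).1 = v := hexShift_injOn hK hO.2.1 hv hval
  have hp : PathIn triGraph {w : Site 2 | triNorm w = K ∧ hexShift K u w ≤ hexShift K u v} u (triBdryIter (triBall K) (u, o) k).1 := by
    refine (pathIn_iter_tails he.1 k).mono fun w hw' => ?_
    obtain ⟨j, hj, hw⟩ := hw'
    obtain ⟨a, -, c⟩ := hall j hj
    rw [← hw]
    exact ⟨a.2.1, c⟩
  rw [hend] at hp
  exact hp

/-- **Arcs of a circle avoiding a site**: two sites of `∂Λ_K` other than `s` are joined inside
`∂Λ_K ∖ {s}`. [folklore] -/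
theorem pathIn_sphere_avoid {K : ℕ} (hK : 1 ≤ K) {u v s : Site 2} (hu : triNorm u = K) (hv : triNorm v = K)
    (hs : triNorm s = K) (hus : u ≠ s) (hvs : v ≠ s) :
    PathIn triGraph {w : Site 2 | triNorm w = K ∧ w ≠ s} u v := by
  have hsu : hexShift K u s ≠ hexShift K u v := fun e => hvs (hexShift_injOn hK hs hv e).symm
  rcases lt_or_gt_of_ne hsu with h | h
  · -- `s` comes before `v` from `u`: go anticlockwise from `v` to `u`
    by_cases huv : u = v
    · subst huv; exact PathIn.refl ⟨hu, hus⟩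
    have h0 : hexShift K u v ≠ 0 := fun e => huv (hexShift_injOn hK hu hv (by rw [hexShift_self, e]))
    have h0s : hexShift K u s ≠ 0 := fun e => hus (hexShift_injOn hK hu hs (by rw [hexShift_self, e]))
    have ruv := hexShift_range hK hu hv
    have rus := hexShift_range hK hu hs
    refine ((pathIn_sphere_arc hK hv hu).mono fun w hw' => show triNorm w = K ∧ w ≠ s from ⟨hw'.1, fun hws => ?_⟩).symm
    have hle := hw'.2
    have r1 := hexShift_range hK hv hw'.1
    have r2 := hexShift_range hK hv hu
    subst hws
    rcases hexShift_rebase hK hu hv hu with e | e <;> rcases hexShift_rebase hK hu hv hs with e' | e' <;>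
      · rw [hexShift_self] at e; omega
  · refine (pathIn_sphere_arc hK hu hv).mono fun w hw' => show triNorm w = K ∧ w ≠ s from ⟨hw'.1, fun hws => ?_⟩
    have hle := hw'.2
    subst hws; omega

end Sweep

/-- **The successor is injective on the boundary darts of a disc.** [folklore] -/
theorem IsTriDisc.succ_inj {G : Finset (Site 2)} {b : Site 2 × Site 2} (hD : IsTriDisc G b)
    {a c : Site 2 × Site 2} (ha : a ∈ triBdryDarts G) (hc : c ∈ triBdryDarts G)
    (h : triBdrySucc G a = triBdrySucc G c) : a = c := by
  obtain ⟨i, hi, rfl⟩ := hD.cycle a ha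
  obtain ⟨j, hj, rfl⟩ := hD.cycle c hc
  rw [← triBdryIter_succ, ← triBdryIter_succ] at h
  have hmod := (hD.iter_eq_iter_iff).1 h
  have hc0 := hD.card_pos
  congr 1
  rcases Nat.lt_or_ge (i + 1) #(triBdryDarts G) with hi1 | hi1 <;>
    rcases Nat.lt_or_ge (j + 1) #(triBdryDarts G) with hj1 | hj1
  · rw [Nat.mod_eq_of_lt hi1, Nat.mod_eq_of_lt hj1] at hmod; omega
  · have : j + 1 = #(triBdryDarts G) := by omega
    rw [this, Nat.mod_self, Nat.mod_eq_of_lt hi1] at hmod; omega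
  · have : i + 1 = #(triBdryDarts G) := by omega
    rw [this, Nat.mod_self, Nat.mod_eq_of_lt hj1] at hmod; omega
  · omega

/-! ### The slit annulus and the order transfer -/

section Slit

variable {n N : ℕ} {S : Set (Site 2)} {s₁ t₁ : Site 2}

/-- **A slit of the annulus `A = {n ≤ |v| ≤ N}`**: the support `S` of a clean crossing path, i.e. a
connected set of sites of `A` containing `s₁ ∈ ∂Λ_n` and `t₁ ∈ ∂Λ_N` and meeting the two circles
nowhere else (`1 ≤ n`, `n + 2 ≤ N`). [folklore] -/
structure IsSlit (n N : ℕ) (S : Set (Site 2)) (s₁ t₁ : Site 2) : Prop where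
  one_le : 1 ≤ n
  le : n + 2 ≤ N
  norm_s : triNorm s₁ = n
  norm_t : triNorm t₁ = N
  mem_t : t₁ ∈ S
  sub : S ⊆ triAnn n N
  conn : ∀ v ∈ S, PathIn triGraph S s₁ v
  clean_in : ∀ v ∈ S, triNorm v = n → v = s₁
  clean_out : ∀ v ∈ S, triNorm v = N → v = t₁

namespace IsSlit

variable (h : IsSlit n N S s₁ t₁)
include h

/-- The inner end is in the slit. [folklore] -/
theorem mem_s : s₁ ∈ S := (h.conn t₁ h.mem_t).left_mem

/-- `1 ≤ N`. [folklore] -/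
theorem one_le_N : 1 ≤ N := le_trans (by omega) h.le

/-- With the slit as configuration, the cluster of `s₁` in the annulus is the slit. [folklore] -/
theorem annCluster_eq : annCluster n N S s₁ = S := by
  ext v
  constructor
  · intro hv; exact (annCluster_subset hv).2
  · intro hv; exact (h.conn v hv).mono fun z hz => ⟨h.sub hz, hz⟩

/-- The component of `q` is closed under paths of `A ∖ S`. [folklore] -/
theorem mem_annComp_of_path {q v w : Site 2} (hv : v ∈ annComp n N S s₁ q) (hp : PathIn triGraph (triAnn n N \ S) v w) :
    w ∈ annComp n N S s₁ q := by
  have hp' : PathIn triGraph (triAnn n N \ annCluster n N S s₁) v w := by rw [h.annCluster_eq]; exact hp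
  exact PathIn.trans hv hp'

/-- A site of `A ∖ S` is in its own component. [folklore] -/
theorem self_mem_annComp {q : Site 2} (hq : q ∈ triAnn n N) (hqS : q ∉ S) : q ∈ annComp n N S s₁ q :=
  PathIn.refl (show q ∈ triAnn n N \ annCluster n N S s₁ by rw [h.annCluster_eq]; exact ⟨hq, hqS⟩)

/-- **Every site of the inner circle other than `s₁` is in the component of an inner site `q ≠ s₁`.** [folklore] -/
theorem inner_mem_annComp {q w : Site 2} (hq : triNorm q = n) (hqs : q ≠ s₁) (hw : triNorm w = n) (hws : w ≠ s₁) :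
    w ∈ annComp n N S s₁ q := by
  have hqA : q ∈ triAnn n N := mem_triAnn.2 ⟨hq.ge, by have := h.le; omega⟩
  have hqS : q ∉ S := fun hqS => hqs (h.clean_in q hqS hq)
  refine h.mem_annComp_of_path (h.self_mem_annComp hqA hqS) ?_
  exact (pathIn_sphere_avoid h.one_le hq hw h.norm_s hqs hws).mono fun z hz =>
    ⟨mem_triAnn.2 ⟨hz.1.ge, by have := h.le; have := hz.1; omega⟩, fun hzS => hz.2 (h.clean_in z hzS hz.1)⟩

/-- **Every site of the outer circle other than `t₁` is in the component**, as soon as the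
component reaches the outer circle. [folklore] -/
theorem outer_mem_annComp {q q' w : Site 2} (hq' : q' ∈ annComp n N S s₁ q) (hq'N : triNorm q' = N)
    (hw : triNorm w = N) (hwt : w ≠ t₁) : w ∈ annComp n N S s₁ q := by
  have hq't : q' ≠ t₁ := fun e => by
    have := (annComp_subset hq').2; rw [h.annCluster_eq, e] at this; exact this h.mem_t
  refine h.mem_annComp_of_path hq' ?_
  exact (pathIn_sphere_avoid h.one_le_N hq'N hw h.norm_t hq't hwt).mono fun z hz =>
    ⟨mem_triAnn.2 ⟨by have := h.le; have := hz.1; omega, hz.1.le⟩, fun hzS => hz.2 (h.clean_out z hzS hz.1)⟩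

/-- The component is a disc (based anywhere on its boundary). [cite: BollobasRiordan2006, Ch. 7 §7.2.2 p. 168] -/
theorem isTriDisc {q : Site 2} (hq : q ∈ annComp n N S s₁ q) {d : Site 2 × Site 2}
    (hd : d ∈ triBdryDarts (annCompFin n N S s₁ q)) : IsTriDisc (annCompFin n N S s₁ q) d := by
  obtain ⟨b, hb⟩ := exists_isTriDisc_annComp (s₂ := q) h.one_le (by have := h.le; omega) h.norm_s h.mem_s
    (show t₁ ∈ annCluster n N S s₁ by rw [h.annCluster_eq]; exact h.mem_t) h.norm_t hq
  exact hb.rebase hd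

/-- A hole dart at an inner site of the component. [folklore] -/
theorem exists_holeDart {q w : Site 2} (hw : w ∈ annComp n N S s₁ q) (hwn : triNorm w = n) :
    ∃ d, HoleDart (annCompFin n N S s₁ q) n d ∧ d.1 = w := by
  obtain ⟨hh, hadj, hhn⟩ := exists_adj_mem_triBall_sub_one h.one_le hwn
  have h1 := h.one_le
  have hhn' : triNorm hh < n := by push_cast [h1] at hhn; omega
  refine ⟨(w, hh), ⟨mem_triBdryDarts.2 ⟨mem_annCompFin.2 hw, fun hm => ?_, hadj⟩, hwn, hhn'⟩, rfl⟩
  have h' : (n : ℤ) ≤ triNorm hh := (mem_triAnn.1 (annComp_subset (mem_annCompFin.1 hm)).1).1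
  omega

omit h in
/-- An outside dart at an outer site of the component. [folklore] -/
theorem exists_outDart {q w : Site 2} (hw : w ∈ annComp n N S s₁ q) (hwN : triNorm w = N) :
    ∃ d, OutDart (annCompFin n N S s₁ q) N d ∧ d.1 = w := by
  obtain ⟨o, hadj, ho⟩ := exists_adj_triNorm_eq_add_one w
  have ho' : (N : ℤ) < triNorm o := by omega
  refine ⟨(w, o), ⟨mem_triBdryDarts.2 ⟨mem_annCompFin.2 hw, fun hm => ?_, hadj⟩, hwN, ho'⟩, rfl⟩
  have h' : triNorm o ≤ (N : ℤ) := (mem_triAnn.1 (annComp_subset (mem_annCompFin.1 hm)).1).2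
  omega

/-- **Order transfer, one direction** (the core): for paths `Q ⊆ X` from `q ∈ ∂Λ_n` to `q' ∈ ∂Λ_N`
and `R ⊆ (A ∖ S) ∖ X` from `r ∈ ∂Λ_n` to `r' ∈ ∂Λ_N`, with `X ⊆ A ∖ S`: if `q` comes before `r`
anticlockwise from `s₁`, then `r'` does not come before `q'` anticlockwise from `t₁`. [cite: BollobasRiordan2006, Ch. 7 Lemma 5 p. 169] -/
theorem not_lt_of_lt {X : Set (Site 2)} (hX : X ⊆ triAnn n N \ S) {q q' r r' : Site 2}
    (hQ : PathIn triGraph X q q') (hR : PathIn triGraph ((triAnn n N \ S) \ X) r r')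
    (hq : triNorm q = n) (hq' : triNorm q' = N) (hr : triNorm r = n) (hr' : triNorm r' = N)
    (hlt : hexShift n s₁ q < hexShift n s₁ r) : ¬ hexShift N t₁ r' < hexShift N t₁ q' := by
  intro hlt'
  have h1 := h.one_le
  have h1N := h.one_le_N
  -- membership facts
  have hqX : q ∈ X := hQ.left_mem
  have hqS : q ∉ S := (hX hqX).2
  have hqs : q ≠ s₁ := fun e => hqS (e ▸ h.mem_s)
  have hrs : r ≠ s₁ := fun e => hR.left_mem.1.2 (e ▸ h.mem_s)
  have hqU : q ∈ annComp n N S s₁ q := h.self_mem_annComp (hX hqX).1 hqS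
  have hQU : PathIn triGraph ((↑(annCompFin n N S s₁ q) : Set (Site 2)) ∩ X) q q' := by
    refine (hQ.to_reach).mono fun z hz =>
      show z ∈ (↑(annCompFin n N S s₁ q) : Set (Site 2)) ∩ X from ⟨?_, (show PathIn triGraph X q z from hz).right_mem⟩
    rw [coe_annCompFin]; exact h.mem_annComp_of_path hqU ((show PathIn triGraph X q z from hz).mono hX)
  have hq'U : q' ∈ annComp n N S s₁ q := by have := hQU.right_mem.1; rwa [Finset.mem_coe, mem_annCompFin] at this
  have hrU : r ∈ annComp n N S s₁ q := h.inner_mem_annComp hq hqs hr hrs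
  have hRU : PathIn triGraph ((↑(annCompFin n N S s₁ q) : Set (Site 2)) ∩ Xᶜ) r' r := by
    refine ((hR.to_reach).mono fun z hz =>
      show z ∈ (↑(annCompFin n N S s₁ q) : Set (Site 2)) ∩ Xᶜ from ⟨?_, (show PathIn triGraph _ r z from hz).right_mem.2⟩).symm
    rw [coe_annCompFin]; exact h.mem_annComp_of_path hrU ((show PathIn triGraph _ r z from hz).mono fun _ hv => hv.1)
  have hr'U : r' ∈ annComp n N S s₁ q := by have := hRU.left_mem.1; rwa [Finset.mem_coe, mem_annCompFin] at this
  have hUlo : ∀ v ∈ (annCompFin n N S s₁ q), (n : ℤ) ≤ triNorm v := fun v hv => (mem_triAnn.1 (annComp_subset (mem_annCompFin.1 hv)).1).1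
  have hUhi : ∀ v ∈ (annCompFin n N S s₁ q), triNorm v ≤ (N : ℤ) := fun v hv => (mem_triAnn.1 (annComp_subset (mem_annCompFin.1 hv)).1).2
  have hfreeIn : ∀ w : Site 2, triNorm w = n → 1 ≤ hexShift n s₁ w → w ∈ (annCompFin n N S s₁ q) := by
    intro w hw h1w
    refine mem_annCompFin.2 (h.inner_mem_annComp hq hqs hw fun e => ?_)
    rw [e, hexShift_self] at h1w; omega
  have hfreeOut : ∀ w : Site 2, triNorm w = N → 1 ≤ hexShift N t₁ w → w ∈ (annCompFin n N S s₁ q) := by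
    intro w hw h1w
    refine mem_annCompFin.2 (h.outer_mem_annComp hq'U hq' hw fun e => ?_)
    rw [e, hexShift_self] at h1w; omega
  -- the base: a hole dart at `q`; the disc
  obtain ⟨dq, hdq, hdq1⟩ := h.exists_holeDart hqU hq
  have hD := h.isTriDisc hqU hdq.1
  -- a hole dart at `r`, and its position
  obtain ⟨dr, hdr, hdr1⟩ := h.exists_holeDart hrU hr
  obtain ⟨p₃, hp₃, hp₃d⟩ := hD.cycle dr hdr.1
  -- the hole sweep from `dr` reaches the base
  have htq : 1 ≤ hexShift n s₁ q := by
    have hne : hexShift n s₁ q ≠ 0 := fun e => hqs (hexShift_injOn h1 hq h.norm_s (by rw [e, hexShift_self]))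
    have := (hexShift_range h1 h.norm_s hq).1; omega
  obtain ⟨k', -, hHk', hvalk', hallk'⟩ := hole_sweep h1 hUlo h.norm_s hfreeIn
    (hexShift n s₁ r - hexShift n s₁ q).toNat hdr (hexShift n s₁ q) htq (by rw [hdr1]; exact hlt.le) (by rw [hdr1]; omega)
  -- the dart reached has tail `q`: it is `dq`, up to one step either way
  have htail : (triBdryIter (annCompFin n N S s₁ q) dr k').1 = dq.1 := by rw [hdq1]; exact hexShift_injOn h1 hHk'.2.1 hq hvalk'
  -- hence some iterate `k'' ≥ 1` of `dr`, preceded by hole darts only, is the base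
  have hreach : ∃ k'', 1 ≤ k'' ∧ triBdryIter (annCompFin n N S s₁ q) dr k'' = dq ∧ ∀ j < k'', HoleDart (annCompFin n N S s₁ q) n (triBdryIter (annCompFin n N S s₁ q) dr j) := by
    have hne : dr ≠ dq := fun e => by
      have : r = q := by rw [← hdr1, e, hdq1]
      rw [this] at hlt; exact lt_irrefl _ hlt
    rcases holeDarts_same_tail h1 hUlo hHk'.1 hHk'.2.1 hHk'.2.2 hdq.1 htail.symm hdq.2.2 with e | e | e
    · refine ⟨k', ?_, e.symm, fun j hj => hallk' j hj.le⟩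
      by_contra h0
      have : k' = 0 := by omega
      rw [this, triBdryIter_zero] at e
      exact hne e.symm
    · exact ⟨k' + 1, by omega, by rw [triBdryIter_succ, ← e], fun j hj => hallk' j (by omega)⟩
    · -- `dq` is the dart just before `iter k' dr`, i.e. `iter (k'-1) dr`, by injectivity of the successor
      have hk'pos : 1 ≤ k' := by
        by_contra h0
        have : k' = 0 := by omega
        rw [this, triBdryIter_zero, hdr1] at hvalk'
        omega
      obtain ⟨k₂, rfl⟩ : ∃ k₂, k' = k₂ + 1 := ⟨k' - 1, by omega⟩
      have e2 : triBdryIter (annCompFin n N S s₁ q) dr k₂ = dq := by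
        rw [triBdryIter_succ] at e
        exact hD.succ_inj (triBdryIter_mem hdr.1 k₂) hdq.1 e
      refine ⟨k₂, ?_, e2, fun j hj => hallk' j (by omega)⟩
      by_contra h0
      have : k₂ = 0 := by omega
      rw [this, triBdryIter_zero] at e2
      exact hne e2
  obtain ⟨k'', hk''1, hk''d, hk''all⟩ := hreach
  -- positions `[p₃, #(triBdryDarts (annCompFin n N S s₁ q)))` carry hole darts
  have hcard_le : #(triBdryDarts (annCompFin n N S s₁ q)) ≤ p₃ + k'' := by
    have e1 : triBdryIter (annCompFin n N S s₁ q) dq (p₃ + k'') = triBdryIter (annCompFin n N S s₁ q) dq 0 := by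
      rw [triBdryIter_add, hp₃d, hk''d, triBdryIter_zero]
    have hmod := (hD.iter_eq_iter_iff).1 e1
    rw [Nat.zero_mod] at hmod
    by_contra hlt2
    rw [Nat.mod_eq_of_lt (by omega)] at hmod
    omega
  have hholes : ∀ j, p₃ ≤ j → j < #(triBdryDarts (annCompFin n N S s₁ q)) → HoleDart (annCompFin n N S s₁ q) n (triBdryIter (annCompFin n N S s₁ q) dq j) := by
    intro j hj1 hj2
    obtain ⟨i, rfl⟩ := Nat.exists_eq_add_of_le hj1
    rw [triBdryIter_add, hp₃d]
    exact hk''all i (by omega)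
  have hexcl : ∀ d, HoleDart (annCompFin n N S s₁ q) n d → ¬ OutDart (annCompFin n N S s₁ q) N d := fun d hh ho => by
    have := hh.2.2; have := ho.2.2; have := h.le; omega
  -- an outside dart at `r'`, at a position `0 < p₁ < p₃`
  obtain ⟨er, her, her1⟩ := exists_outDart hr'U hr'
  obtain ⟨p₁, hp₁, hp₁d⟩ := hD.cycle er her.1
  have hp₁lt : p₁ < p₃ := by
    by_contra hge
    refine hexcl _ (hholes p₁ (by omega) hp₁) ?_
    rw [hp₁d]; exact her
  have hp₁pos : 0 < p₁ := by
    by_contra h0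
    have : p₁ = 0 := by omega
    rw [this, triBdryIter_zero] at hp₁d
    refine hexcl _ hdq ?_
    rw [hp₁d]; exact her
  -- the outside sweep from `er` reaches `q'` at position `p₁ + k < p₃`
  have hTq : hexShift N t₁ q' < 6 * N := (hexShift_range h1N h.norm_t hq').2
  obtain ⟨k, -, hOk, hvalk, hallk⟩ := out_sweep h1N hUhi h.norm_t hfreeOut
    (hexShift N t₁ q' - hexShift N t₁ r').toNat her (hexShift N t₁ q') (by rw [her1]; exact hlt'.le) hTq
    (by rw [her1]; omega)
  have hkpos : 0 < k := by
    by_contra h0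
    have : k = 0 := by omega
    rw [this, triBdryIter_zero, her1] at hvalk
    omega
  have htailq : (triBdryIter (annCompFin n N S s₁ q) er k).1 = q' := hexShift_injOn h1N hOk.2.1 hq' hvalk
  have hp₂lt : p₁ + k < p₃ := by
    by_contra hge
    obtain ⟨ho, -, -⟩ := hallk (p₃ - p₁) (by omega)
    have e : triBdryIter (annCompFin n N S s₁ q) er (p₃ - p₁) = dr := by
      rw [← hp₁d, ← triBdryIter_add, Nat.add_sub_cancel' hp₁lt.le, hp₃d]
    exact hexcl dr hdr (e ▸ ho)
  -- the two paths are interleaved on the boundary of the disc: impossible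
  refine hD.not_interleaved X hp₁pos (Nat.lt_add_of_pos_right hkpos) hp₂lt hp₃ ?_ ?_
  · rw [triBdryIter_zero, hdq1, triBdryIter_add, hp₁d, htailq]; exact hQU
  · rw [hp₁d, her1, hp₃d, hdr1]; exact hRU

/-- **Order transfer across the annulus** (crossing paths of the slit annulus meet the two circles
in the same cyclic order): for a path `Q` of `X ⊆ A ∖ S` from `q ∈ ∂Λ_n` to `q' ∈ ∂Λ_N` and a path
`R` of `(A ∖ S) ∖ X` from `r ∈ ∂Λ_n` to `r' ∈ ∂Λ_N`, `q` comes before `r` anticlockwise from `s₁` on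
the inner circle iff `q'` comes before `r'` anticlockwise from `t₁` on the outer circle. [cite: BollobasRiordan2006, Ch. 7 Lemma 5 p. 169] -/
theorem hexShift_lt_iff {X : Set (Site 2)} (hX : X ⊆ triAnn n N \ S) {q q' r r' : Site 2}
    (hQ : PathIn triGraph X q q') (hR : PathIn triGraph ((triAnn n N \ S) \ X) r r')
    (hq : triNorm q = n) (hq' : triNorm q' = N) (hr : triNorm r = n) (hr' : triNorm r' = N) :
    hexShift n s₁ q < hexShift n s₁ r ↔ hexShift N t₁ q' < hexShift N t₁ r' := by
  have h1 := h.one_le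
  have h1N := h.one_le_N
  have hqr : q ≠ r := fun e => hR.left_mem.2 (e ▸ hQ.left_mem)
  have hq'r' : q' ≠ r' := fun e => hR.right_mem.2 (e ▸ hQ.right_mem)
  have hne : hexShift n s₁ q ≠ hexShift n s₁ r := fun e => hqr (hexShift_injOn h1 hq hr e)
  have hne' : hexShift N t₁ q' ≠ hexShift N t₁ r' := fun e => hq'r' (hexShift_injOn h1N hq' hr' e)
  have hX' : (triAnn n N \ S) \ X ⊆ triAnn n N \ S := fun _ hv => hv.1
  have hQ' : PathIn triGraph ((triAnn n N \ S) \ ((triAnn n N \ S) \ X)) q q' :=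
    hQ.mono fun z hz => ⟨hX hz, fun h' => h'.2 hz⟩
  constructor
  · intro hlt
    rcases lt_or_gt_of_ne hne' with h' | h'
    · exact h'
    · exact absurd h' (h.not_lt_of_lt hX hQ hR hq hq' hr hr' hlt)
  · intro hlt'
    rcases lt_or_gt_of_ne hne with h' | h'
    · exact h'
    · exact absurd hlt' (h.not_lt_of_lt hX' hR hQ' hr hr' hq hq' h')

end IsSlit

end Slit

end Literature.Probability.Percolation
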